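import Summits.CriticalPhenomena.CardyFormulaZ2.Theorems.CardySelfRefinementLagHandOffHalfPlaneTwoArmUndockedStep
import Summits.CriticalPhenomena.CardyFormulaZ2.Theorems.CardySelfRefinementLagHandOffHalfPlaneTwoArmUndockedReduction
import Summits.CriticalPhenomena.CardyFormulaZ2.Theorems.CardySelfRefinementLagHandOffHalfPlaneThreeArmUndocked
import HarnessLib

/-!
# The undocked half-plane two-arm bound (X) and the undocked half-plane three-arm bound

Closes the registered stub `stub_noTouch_undockedThreeArm` of crux stmt-CriticalPhenomena-10268
(line `hitting-tournament`): the UNdocked polychromatic half-plane three-arm bound with exponent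
`1 + α` for critical bond percolation on `ℤ²`, for every half-disc direction `u` (`u⁴ = 1`).  By
the landed reduction `stub_noTouch_undockedThreeArm_of_twoArm` it suffices to prove the undocked
half-plane TWO-arm bound (X) with exponent `1 - ε` for every `ε > 0` (an open path and a disjoint
dual-open path crossing the upper half-annulus, NOT required to start on the boundary line).

Proof of (X) — a separation-free bootstrap of the exponent.  Let `α > 0` be a common exponent of
the RSW one-arm bounds for open and for closed dual annulus crossings.  (i) A priori the event has
probability `≤ 4^α (r/R)^α` (the open arm alone, `stub_undockedTwoArm_apriori`).  (ii) If the bound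
holds with exponent `θ`, it holds with every exponent `η < min 1 (θ + α)`: at each of `J ≍ log(R/r)`
scales either the two arms dock on the boundary row and its moat (probability `≤ C_d S'_j/R`, from
the DOCKED three-arm bound `stub_undockedThreeArm_docked_le` — quad-crossing duality and
Werner's counting), or three arms occur at that scale (probability `≤ A L^{-(θ+α)}` by Reimer's
inequality); summing over the first docking scale with independence of disjoint edge annuli gives
the lattice-centre bound (`stub_undockedTwoArm_latticeStep`), transported to all centres and
meshes by `stub_undockedTwoArm_ofLattice`.  (iii) Iterating (ii) `⌈2/α⌉` times from (i) reaches
every exponent `< 1`: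

* `stub_undockedTwoArm_bootstrap` — the bound with every exponent `η ≤ (n+1) α/2`, `η < 1`;
* `stub_undockedTwoArm_bound` — **(X): the undocked half-plane two-arm bound with exponent
  `1 - ε`, every `ε > 0`;**
* `stub_noTouch_undockedThreeArm` — **the registered stub.**

References: G. F. Lawler, O. Schramm, W. Werner, Electron. J. Probab. 7 (2002), Appendix A
[LawlerSchrammWernerEJP2002]; H. Kesten, Comm. Math. Phys. 109 (1987) [KestenScalingCMP1987];
S. Smirnov, W. Werner, Math. Res. Lett. 8 (2001), §3 [SmirnovWerner2001]; D. Reimer, Combin.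
Probab. Comput. 9 (2000) [ReimerCPC2000]; G. Grimmett, *Percolation* (1999), §11.7
[GrimmettPercolation1999].
-/

noncomputable section

open Set Metric Complex MeasureTheory
open Literature.Probability.Percolation Literature.Probability.LatticeModels

namespace Summit.CriticalPhenomena.CardyFormulaZ2.Cruxes.LagHandOff.HittingTournament

/-- The undocked two-arm bound with exponent `η` and constants `C, cb, K` (the matrix of (X)), as
a local notation. -/
local notation3 "UBound[" η ", " C ", " cb ", " K "]" =>
  ∀ (x : ℂ) (δ r R : ℝ), 0 < δ → cb * δ ≤ r → K * r ≤ R → ∀ S : Set (Site 2),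
    S = {v | r ≤ dist (meshPoint δ v) x ∧ dist (meshPoint δ v) x ≤ R ∧ x.im ≤ (meshPoint δ v).im} →
    (bondPercolation (zdGraph 2) half).real {ω | ∃ v w f g : Site 2,
      dist (meshPoint δ v) x ≤ 2 * r ∧ dist (meshPoint δ f) x ≤ 2 * r ∧
      R / 2 ≤ dist (meshPoint δ w) x ∧ R / 2 ≤ dist (meshPoint δ g) x ∧
      ω ∈ openConnIn S v w ∧ dualConfig ω ∈ openConnIn S f g} ≤ C * (r / R) ^ η

/-! ### The bootstrap -/

/-- **One bootstrap step in the general form**: the bound with exponent `θ > 0` and the RSW dual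
bound with exponent `α` give the bound with every exponent `0 < η < 1`, `η < θ + α` (lattice step
`stub_undockedTwoArm_latticeStep` and the transport `stub_undockedTwoArm_ofLattice`).
[cite: KestenScalingCMP1987, Lemma 4] -/
theorem twoArmBound_step {θ C cb K : ℝ} (hθ : 0 < θ) (hC : 0 < C) (hcb : 0 < cb) (hK : 1 ≤ K)
    (hX : UBound[θ, C, cb, K]) {α ca : ℝ} (hα : 0 < α) (hca : 0 < ca)
    (hRSW : ∀ (x : ℂ) (δ r R : ℝ), 0 < δ → ca * δ ≤ r → 2 * r ≤ R →
      (bondPercolation (zdGraph 2) half).real (annulusDualCrossing x δ r R) ≤ (r / R) ^ α)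
    {η : ℝ} (hη0 : 0 < η) (hη1 : η < 1) (hηκ : η < θ + α) :
    ∃ C' cb' K' : ℝ, 0 < C' ∧ 0 < cb' ∧ 1 ≤ K' ∧ UBound[η, C', cb', K'] := by
  obtain ⟨C', cb', K', hC', hcb', hK', hlat⟩ :=
    stub_undockedTwoArm_latticeStep hθ hC hcb hK hX hα hca hRSW η hη0 hη1 hηκ
  refine ⟨C' * 6 ^ η, max cb' 2, 3 * K' + 8, by positivity, lt_of_lt_of_le hcb' (le_max_left _ _), by linarith, ?_⟩
  exact stub_undockedTwoArm_ofLattice hη0.le hC'.le hK' hlat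

/-- **The bootstrap**: given the a priori bound with exponent `α` and the RSW dual bound with the
same exponent `α`, the undocked two-arm bound holds with every exponent `η ≤ (n + 1) α / 2`,
`0 < η < 1`, for every `n` (induction on `n`, each step gaining `α/2`).
[cite: LawlerSchrammWernerEJP2002, Appendix A] -/
theorem stub_undockedTwoArm_bootstrap : ∀ {α ca C₀ cb₀ K₀ : ℝ}, 0 < α → 0 < ca → 0 < C₀ → 0 < cb₀ → 1 ≤ K₀ →
    (∀ (x : ℂ) (δ r R : ℝ), 0 < δ → ca * δ ≤ r → 2 * r ≤ R →
      (bondPercolation (zdGraph 2) half).real (annulusDualCrossing x δ r R) ≤ (r / R) ^ α) →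
    (∀ (x : ℂ) (δ r R : ℝ), 0 < δ → cb₀ * δ ≤ r → K₀ * r ≤ R → ∀ S : Set (Site 2),
      S = {v | r ≤ dist (meshPoint δ v) x ∧ dist (meshPoint δ v) x ≤ R ∧ x.im ≤ (meshPoint δ v).im} →
      (bondPercolation (zdGraph 2) half).real {ω | ∃ v w f g : Site 2,
        dist (meshPoint δ v) x ≤ 2 * r ∧ dist (meshPoint δ f) x ≤ 2 * r ∧
        R / 2 ≤ dist (meshPoint δ w) x ∧ R / 2 ≤ dist (meshPoint δ g) x ∧
        ω ∈ openConnIn S v w ∧ dualConfig ω ∈ openConnIn S f g} ≤ C₀ * (r / R) ^ α) →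
    ∀ (n : ℕ) (η : ℝ), 0 < η → η ≤ (n + 1) * (α / 2) → η < 1 →
    ∃ C cb K : ℝ, 0 < C ∧ 0 < cb ∧ 1 ≤ K ∧ ∀ (x : ℂ) (δ r R : ℝ), 0 < δ → cb * δ ≤ r → K * r ≤ R →
      ∀ S : Set (Site 2),
      S = {v | r ≤ dist (meshPoint δ v) x ∧ dist (meshPoint δ v) x ≤ R ∧ x.im ≤ (meshPoint δ v).im} →
      (bondPercolation (zdGraph 2) half).real {ω | ∃ v w f g : Site 2,
        dist (meshPoint δ v) x ≤ 2 * r ∧ dist (meshPoint δ f) x ≤ 2 * r ∧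
        R / 2 ≤ dist (meshPoint δ w) x ∧ R / 2 ≤ dist (meshPoint δ g) x ∧
        ω ∈ openConnIn S v w ∧ dualConfig ω ∈ openConnIn S f g} ≤ C * (r / R) ^ η := by
  intro α ca C₀ cb₀ K₀ hα hca hC₀ hcb₀ hK₀ hRSW h₀ n
  induction n with
  | zero =>
    intro η hη0 hηle hη1
    refine ⟨C₀, cb₀, K₀, hC₀, hcb₀, hK₀, ?_⟩
    have hηα : η ≤ α := by push_cast at hηle; linarith
    exact twoArmBound_mono_exponent hηα hC₀.le hcb₀ hK₀ h₀
  | succ n ih =>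
    intro η hη0 hηle hη1
    by_cases hsmall : η ≤ (n + 1) * (α / 2)
    · exact ih η hη0 hsmall hη1
    · push Not at hsmall
      set θ : ℝ := η - α / 2 with hθ
      have hθ0 : 0 < θ := by
        rw [hθ]
        have : (0 : ℝ) ≤ n * (α / 2) := by positivity
        nlinarith
      have hθle : θ ≤ (n + 1) * (α / 2) := by rw [hθ]; push_cast at hηle ⊢; linarith
      have hθ1 : θ < 1 := by rw [hθ]; linarith
      obtain ⟨C, cb, K, hC, hcb, hK, hXθ⟩ := ih θ hθ0 hθle hθ1
      exact twoArmBound_step hθ0 hC hcb hK hXθ hα hca hRSW hη0 hη1 (by rw [hθ]; linarith)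

/-! ### (X) and the registered stub -/

/-- **(X) — the undocked half-plane two-arm bound for critical bond percolation on `ℤ²`.**  For
every `ε > 0` there are `C, c₀ > 0`, `K ≥ 1` such that for every centre `x`, mesh `δ > 0` and radii
`c₀ δ ≤ r`, `K r ≤ R`, the event "an open path and a dual-open path cross the upper half-annulus
`{r ≤ dist ≤ R, im ≥ im x}` from distance `≤ 2r` to distance `≥ R/2`" has probability at most
`C (r/R)^{1-ε}`. [cite: LawlerSchrammWernerEJP2002, Appendix A] -/
theorem stub_undockedTwoArm_bound : ∀ ε : ℝ, 0 < ε → ∃ C c₀ K : ℝ, 0 < C ∧ 0 < c₀ ∧ 1 ≤ K ∧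
    ∀ (x : ℂ) (δ r R : ℝ), 0 < δ → c₀ * δ ≤ r → K * r ≤ R → ∀ S : Set (Site 2),
      S = {v | r ≤ dist (meshPoint δ v) x ∧ dist (meshPoint δ v) x ≤ R ∧ x.im ≤ (meshPoint δ v).im} →
      (bondPercolation (zdGraph 2) half).real {ω | ∃ v w f g : Site 2,
        dist (meshPoint δ v) x ≤ 2 * r ∧ dist (meshPoint δ f) x ≤ 2 * r ∧
        R / 2 ≤ dist (meshPoint δ w) x ∧ R / 2 ≤ dist (meshPoint δ g) x ∧
        ω ∈ openConnIn S v w ∧ dualConfig ω ∈ openConnIn S f g} ≤ C * (r / R) ^ (1 - ε) := by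
  intro ε hε
  -- a common RSW exponent for open and closed annulus crossings
  obtain ⟨αo, co, hαo, hco, hopen⟩ := annulusOpenCrossing_half_le_holds
  obtain ⟨αd, cd, hαd, hcd, hdual⟩ := annulusDualCrossing_half_le_holds
  set α : ℝ := min αo αd with hαdef
  have hα : 0 < α := lt_min hαo hαd
  have hratio : ∀ {c r R δ : ℝ}, 0 < δ → 0 < c → c * δ ≤ r → 2 * r ≤ R → 0 < r / R ∧ r / R ≤ 1 := by
    intro c r R δ hδ hc hr hR
    have hr0 : 0 < r := lt_of_lt_of_le (by positivity) hr
    have hR0 : 0 < R := by linarith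
    exact ⟨by positivity, by rw [div_le_one hR0]; linarith⟩
  have hRSW : ∀ (x : ℂ) (δ r R : ℝ), 0 < δ → cd * δ ≤ r → 2 * r ≤ R →
      (bondPercolation (zdGraph 2) half).real (annulusDualCrossing x δ r R) ≤ (r / R) ^ α := by
    intro x δ r R hδ hr hR
    obtain ⟨h0, h1⟩ := hratio hδ hcd hr hR
    exact (hdual x δ r R hδ hr hR).trans (Real.rpow_le_rpow_of_exponent_ge h0 h1 (min_le_right _ _))
  have hopen' : ∀ (x : ℂ) (δ r R : ℝ), 0 < δ → co * δ ≤ r → 2 * r ≤ R →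
      (bondPercolation (zdGraph 2) half).real (annulusOpenCrossing x δ r R) ≤ (r / R) ^ α := by
    intro x δ r R hδ hr hR
    obtain ⟨h0, h1⟩ := hratio hδ hco hr hR
    exact (hopen x δ r R hδ hr hR).trans (Real.rpow_le_rpow_of_exponent_ge h0 h1 (min_le_left _ _))
  -- the a priori bound and the bootstrap
  have h₀ : UBound[α, 4 ^ α, co, 8] := fun x δ r R hδ hr hR S hS =>
    stub_undockedTwoArm_apriori hα hco hopen' x δ r R hδ hr hR S hS
  set ε' : ℝ := min ε (1 / 2) with hε'
  have hε'0 : 0 < ε' := lt_min hε (by norm_num)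
  have hε'le : ε' ≤ ε := min_le_left _ _
  have hε'half : ε' ≤ 1 / 2 := min_le_right _ _
  set n : ℕ := ⌈2 / α⌉₊ with hn
  have hnα : 1 ≤ (n + 1) * (α / 2) := by
    have h1 : 2 / α ≤ n := Nat.le_ceil _
    have h2 : 2 / α * (α / 2) = 1 := by field_simp
    nlinarith
  obtain ⟨C, cb, K, hC, hcb, hK, hbound⟩ := stub_undockedTwoArm_bootstrap hα hcd (by positivity) hco (by norm_num)
    hRSW h₀ n (1 - ε') (by linarith) (by linarith) (by linarith)
  exact ⟨C, cb, K, hC, hcb, hK, twoArmBound_mono_exponent (by linarith) hC.le hcb hK hbound⟩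

/-- **The undocked polychromatic half-plane three-arm bound** (registered stub of the crux
`LagHandOff`, line `hitting-tournament`): for every direction `u` with `u⁴ = 1`, the event that
the half-annulus `{r ≤ dist ≤ R, Re(ū(z - x)) ≤ 0}` at mesh `δ` is crossed from distance `≤ 2r` to
distance `≥ R/2` by two open paths not joined by an open path of the half-annulus, or by two such
dual-open paths, has probability `≤ C (r/R)^{1+α}`; from (X) (`stub_undockedTwoArm_bound`) by the
landed reduction `stub_noTouch_undockedThreeArm_of_twoArm`.
[cite: SmirnovWerner2001, §3 (half-plane 3-arm exponent 2 on 𝕋; here only `> 1` on ℤ²)] -/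
theorem stub_noTouch_undockedThreeArm : (∃ C α : ℝ, 0 < C ∧ 0 < α ∧ ∃ c₀ K : ℝ, 0 < c₀ ∧ 1 ≤ K ∧ ∀ u : ℂ, u ^ 4 = 1 → ∀ (x : ℂ) (δ r R : ℝ), 0 < δ → c₀ * δ ≤ r → K * r ≤ R → ∀ S : Set (Site 2), S = {v | r ≤ dist (meshPoint δ v) x ∧ dist (meshPoint δ v) x ≤ R ∧ (starRingEnd ℂ u * (meshPoint δ v - x)).re ≤ 0} → (bondPercolation (zdGraph 2) half).real {ω | ∃ v₁ w₁ v₂ w₂ : Site 2, dist (meshPoint δ v₁) x ≤ 2 * r ∧ dist (meshPoint δ v₂) x ≤ 2 * r ∧ R / 2 ≤ dist (meshPoint δ w₁) x ∧ R / 2 ≤ dist (meshPoint δ w₂) x ∧ ((ω ∈ openConnIn S v₁ w₁ ∧ ω ∈ openConnIn S v₂ w₂ ∧ ω ∉ openConnIn S v₁ v₂) ∨ (dualConfig ω ∈ openConnIn S v₁ w₁ ∧ dualConfig ω ∈ openConnIn S v₂ w₂ ∧ dualConfig ω ∉ openConnIn S v₁ v₂))} ≤ C * (r / R) ^ (1 +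 α)) :=
  stub_noTouch_undockedThreeArm_of_twoArm stub_undockedTwoArm_bound

end Summit.CriticalPhenomena.CardyFormulaZ2.Cruxes.LagHandOff.HittingTournament
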